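import Summits.BirchSwinnertonDyer.Rank1Residual.Additive.RamifiedSevenGenusKummerTwist
import Summits.BirchSwinnertonDyer.BirchSwinnertonDyer.Theorems.PrintCf2RubinValueTwoRowTwoCosetNorm
import Literature.NumberTheory.GaloisRepresentations.SubgroupKummerCosetNormTransitivity
import HarnessLib

/-!
# `𝒞₇` genus road (crux `EllipticUnitValueSevenOfGZK`, K7r), row K2C-12 = (B2′) KUMMER NON-VANISHING, File L5b-i:
# THE NORM TOWER OF THE TWISTED NORMS — `K̄`-side coherence of `bₘ = N_{Hₘ/Vₘ}(z_m)` and of the twisted norms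
# `Cₘ = ∏_δ (t m δ · bₘ)^{k_δ}`, Kőnig's lemma, and the transport of coset norms to the field norms `N_{F′ₘ₊₁/F′ₘ}`

Cell bsd-cm, seat bsd-cm-k-ty1 g32; pen START packet `bsd-cm-plan/g38/START-kty1-g32.md` §2 (L5b «König + norm-coherence
semilocal half»); ruling D1082.  Setting of Files A2a/A2b/TWa/TWb (`e`, `c`, `Hₘ = layerFixing F e m`) plus an abstract tower
`V m ≤ Hₘ` of open subgroups with a unit tower `z m ∈ (K̄ˣ)^{V m}`, `N_{Vₘ/Vₘ₊₁} z_{m+1} = z_m` (the road: Kato's `V s`, `z_s = _𝔞z_{7^s𝔣}`,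
`KummerFrame.UnitTower`), and level-INDEPENDENT twist data `t m δ`, `k_δ` (File TWb) with `(t m δ)⁻¹ t (m+1) δ ∈ Hₘ`.
* §1 ★ `coe_apply_prod_smul_eq_normOver` — TRANSPORT: `e(N_{Hₘ/Hₘ'}(w)) = N_{F′ₘ'/F′ₘ}(e w)` (`normOver`) for `Hₘ'`-fixed units `w`
  (`c(Hₘ) = Gal(ℚ̄/F′ₘ)`, `c` injective, the tree's `RowTwo.prod_smul_eq_normOver`).
* §2 `forall_smul_cosetNorm_eq`, `cosetNorm_succ_eq` — `bₘ` is `Hₘ`-fixed and `N_{Hₘ/Hₘ₊₁} bₘ₊₁ = bₘ` (transitivity twice, Literature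
  `prod_smul_prod_smul_eq`); `forall_smul_twistedNorm_eq`, `twistedNorm_succ_eq` — the same for `Cₘ` (equivariance `prod`/`smul`, Literature
  `smul_prod_smul_eq`, and `t (m+1) δ · bₘ = t m δ · bₘ`).
* §3 ★★ `exists_normCoherent_seventh_roots` — if every `Cₘ` (`m ≥ 1`) has an `Hₘ`-fixed 7th root (the output of the coboundary test L4b),
  then there is a NORM-COHERENT family of such roots `a j` (level `j+1`), with its norm relation already read as
  `N_{F′_{j+2}/F′_{j+1}}(e a_{j+1}) = e a_j` (Kőnig, Literature `exists_normCoherent_roots`).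
HONEST LABEL: Galois bookkeeping; theorems only (no definition, no named fact, no instance, no sorry); nothing closes; (B2′) NOT
proved here; stmt-BirchSwinnertonDyer-19945 OPEN; BSD claimed for no curve.

## References
* K. Kato, Astérisque 295 (2004), §15.5 (p. 253, the units `_𝔞z_{p^s𝔣}` and their norm relations), 15.14 (p. 264). [Kato2004Asterisque]
* K. Rubin, LNM 1716 (1999), §7 (U_∞ = lim← U_n), Lemma 9.3. [Rubin1999]
* J.-P. Serre, *Local Fields* (1979), X §3 b). [Serre1979]
* J. Neukirch, *Algebraic Number Theory* (1999), Ch. IV §1. [NeukirchANT1999]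
-/

noncomputable section

open scoped NumberField
open Field
open Literature.NumberTheory.IwasawaTheory
open Literature.NumberTheory.GaloisRepresentations Literature.NumberTheory.GaloisRepresentations.LocalWeilDatum
open Literature.NumberTheory.EllipticCurves
open Literature.NumberTheory.ComplexMultiplication.EllipticUnits
open Summit.BirchSwinnertonDyer.BirchSwinnertonDyer.Theorems.PrintCf2
open Summit.BirchSwinnertonDyer.BirchSwinnertonDyer.Theorems.PrintCf2.LeopoldtAtV

namespace Summit.BirchSwinnertonDyer.Rank1Residual.Additive.GenusSeven

namespace GenusFrame

variable (F : GenusFrame) {Kcm : Type} [Field Kcm] [NumberField Kcm]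
  (e : AlgebraicClosure Kcm →+* AlgebraicClosure ℚ) {c : absoluteGaloisGroup Kcm →* absoluteGaloisGroup ℚ}

/-! ## §1 Transport of coset norms to the field norms of the layers -/

/-- The layers `F′ₘ` are Galois over `ℚ`. [cite: NeukirchANT1999, Ch. IV §1] -/
theorem isGalois_layer (m : ℕ) : IsGalois ℚ (F.layer m) :=
  haveI : Normal ℚ (F.layer m) := F.normal_layer m
  IsGalois.mk

omit [NumberField Kcm] in
/-- A unit of `K̄` fixed by `Hₘ` has `e`-image in `F′ₘ` (L1b on units). [cite: NeukirchANT1999, Ch. IV §1 Thm. (1.2)] -/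
theorem apply_coe_mem_layer [NumberField Kcm]
    (hc : ∀ (σ : absoluteGaloisGroup Kcm) (z : AlgebraicClosure Kcm), e (σ • z) = c σ • e z)
    (hbij : Function.Bijective e) (h2 : Module.finrank ℚ Kcm = 2) {s : Kcm} (hs : s ^ 2 = -7)
    (hrange : ∀ g : absoluteGaloisGroup ℚ, g ∈ c.range ↔
      ∀ x : Kcm, g • e (algebraMap Kcm (AlgebraicClosure Kcm) x) = e (algebraMap Kcm (AlgebraicClosure Kcm) x))
    (m : ℕ) {w : (AlgebraicClosure Kcm)ˣ} (hw : ∀ σ : layerFixing F e m, (σ : absoluteGaloisGroup Kcm) • w = w) :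
    e (w : AlgebraicClosure Kcm) ∈ F.layer m :=
  F.apply_mem_layer_of_forall_smul_eq e hc hbij h2 hs hrange m fun σ hσ ↦ by
    rw [← Units.coe_smul, hw ⟨σ, hσ⟩]

/-- ★ **TRANSPORT OF COSET NORMS TO FIELD NORMS**: for `m ≤ m'`, a section `t` of `Hₘ → Hₘ/Hₘ'` and a unit `w` of `K̄` with `e w ∈ F′ₘ'`,
`e(∏ₓ t(x)·w) = N_{F′ₘ'/F′ₘ}(e w)` — the `c(t x)` represent `Gal(ℚ̄/F′ₘ)/Gal(ℚ̄/F′ₘ')` exactly once (`c(Hₙ) = Gal(ℚ̄/F′ₙ)`, `c` injective)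
and `normOver` is the product of conjugates over any such system (`RowTwo.prod_smul_eq_normOver`).
[cite: NeukirchANT1999, Ch. IV §1] [cite: Serre1979, X §3 b)] [cite: Kato2004Asterisque, 15.14 (p. 264)] -/
theorem coe_apply_prod_smul_eq_normOver
    (hc : ∀ (σ : absoluteGaloisGroup Kcm) (z : AlgebraicClosure Kcm), e (σ • z) = c σ • e z)
    (hbij : Function.Bijective e) (h2 : Module.finrank ℚ Kcm = 2) {s : Kcm} (hs : s ^ 2 = -7)
    (hrange : ∀ g : absoluteGaloisGroup ℚ, g ∈ c.range ↔
      ∀ x : Kcm, g • e (algebraMap Kcm (AlgebraicClosure Kcm) x) = e (algebraMap Kcm (AlgebraicClosure Kcm) x))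
    {m m' : ℕ} (hmm' : m ≤ m') [Fintype (layerFixing F e m ⧸ (layerFixing F e m').subgroupOf (layerFixing F e m))]
    {t : layerFixing F e m ⧸ (layerFixing F e m').subgroupOf (layerFixing F e m) → layerFixing F e m}
    (ht : ∀ x, (t x : layerFixing F e m ⧸ (layerFixing F e m').subgroupOf (layerFixing F e m)) = x)
    {w : (AlgebraicClosure Kcm)ˣ} (hez : e (w : AlgebraicClosure Kcm) ∈ F.layer m') :
    e ((∏ x, ((t x : layerFixing F e m) : absoluteGaloisGroup Kcm) • w : (AlgebraicClosure Kcm)ˣ) : AlgebraicClosure Kcm) =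
      ((normOver (F.layer m') (F.layer m) ⟨e (w : AlgebraicClosure Kcm), hez⟩ : F.layer m') : AlgebraicClosure ℚ) := by
  classical
  -- instances of the layers (passed explicitly to `RowTwo.prod_smul_eq_normOver`: the `ℚ`-algebra structure of `ℚ̄` carried by
  -- the layers is only definitionally the one of the generic statement)
  have hle : F.layer m ≤ F.layer m' := cyclotomicLayer_monotone F.F₀ 7 hmm'
  haveI instFD : FiniteDimensional ℚ (F.layer m') := F.finiteDimensional_layer m'
  haveI instG : IsGalois ℚ (F.layer m') := F.isGalois_layer m'
  haveI : CompactSpace (absoluteGaloisGroup ℚ) := absoluteGaloisGroup_compactSpace ℚ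
  haveI : (galFixing ℚ (F.layer m')).FiniteIndex := finiteIndex_of_isOpen_of_compactSpace _ (isOpen_galFixing ℚ (F.layer m'))
  letI instFT : Fintype (galFixing ℚ (F.layer m) ⧸ (galFixing ℚ (F.layer m')).subgroupOf (galFixing ℚ (F.layer m))) := Fintype.ofFinite _
  -- the transported representatives
  have hmemH : ∀ x, c ((t x : layerFixing F e m) : absoluteGaloisGroup Kcm) ∈ galFixing ℚ (F.layer m) := fun x ↦
    (F.mem_layerFixing_iff_mem_galFixing e hc hbij m _).mp (t x).2
  let r : layerFixing F e m ⧸ (layerFixing F e m').subgroupOf (layerFixing F e m) → galFixing ℚ (F.layer m) :=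
    fun x ↦ ⟨c ((t x : layerFixing F e m) : absoluteGaloisGroup Kcm), hmemH x⟩
  have hr : ∀ x, ((r x : galFixing ℚ (F.layer m)) : absoluteGaloisGroup ℚ) = c ((t x : layerFixing F e m) : absoluteGaloisGroup Kcm) :=
    fun x ↦ rfl
  have hrinj : Function.Injective fun x ↦ (r x : galFixing ℚ (F.layer m) ⧸ (galFixing ℚ (F.layer m')).subgroupOf (galFixing ℚ (F.layer m))) := by
    intro x y hxy
    have hmem := QuotientGroup.eq.mp hxy
    rw [Subgroup.mem_subgroupOf, Subgroup.coe_mul, Subgroup.coe_inv, hr, hr, ← map_inv, ← map_mul,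
      ← F.mem_layerFixing_iff_mem_galFixing e hc hbij m'] at hmem
    rw [← ht x, ← ht y]
    exact QuotientGroup.eq.mpr (by rw [Subgroup.mem_subgroupOf, Subgroup.coe_mul, Subgroup.coe_inv]; exact hmem)
  have hrsurj : Function.Surjective fun x ↦
      (r x : galFixing ℚ (F.layer m) ⧸ (galFixing ℚ (F.layer m')).subgroupOf (galFixing ℚ (F.layer m))) := by
    intro q
    induction q using QuotientGroup.induction_on with
    | H g =>
      obtain ⟨σ, hσ⟩ := F.galFixing_layer_le_range e h2 hs hrange m g.2
      have hσH : σ ∈ layerFixing F e m := (F.mem_layerFixing_iff_mem_galFixing e hc hbij m σ).mpr (hσ ▸ g.2)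
      refine ⟨(((⟨σ, hσH⟩ : layerFixing F e m)) : layerFixing F e m ⧸ (layerFixing F e m').subgroupOf (layerFixing F e m)),
        QuotientGroup.eq.mpr ?_⟩
      have hq := QuotientGroup.eq.mp (ht (((⟨σ, hσH⟩ : layerFixing F e m)) :
        layerFixing F e m ⧸ (layerFixing F e m').subgroupOf (layerFixing F e m)))
      rw [Subgroup.mem_subgroupOf, Subgroup.coe_mul, Subgroup.coe_inv, Subgroup.coe_mk,
        F.mem_layerFixing_iff_mem_galFixing e hc hbij m', map_mul, map_inv, hσ] at hq
      rw [Subgroup.mem_subgroupOf, Subgroup.coe_mul, Subgroup.coe_inv, hr]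
      exact hq
  -- the unit `e w` of `ℚ̄`, fixed by `Gal(ℚ̄/F′ₘ')`
  have hwfix : ∀ g : galFixing ℚ (F.layer m'), (g : absoluteGaloisGroup ℚ) • Units.map (e : AlgebraicClosure Kcm →* AlgebraicClosure ℚ) w =
      Units.map (e : AlgebraicClosure Kcm →* AlgebraicClosure ℚ) w := fun g ↦ Units.ext (by
    rw [Units.coe_smul, Units.coe_map, MonoidHom.coe_coe]
    exact (mem_galFixing_iff ℚ).mp g.2 _ hez)
  have step : e ((∏ x, ((t x : layerFixing F e m) : absoluteGaloisGroup Kcm) • w : (AlgebraicClosure Kcm)ˣ) : AlgebraicClosure Kcm) =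
      ((∏ x, ((r x : galFixing ℚ (F.layer m)) : absoluteGaloisGroup ℚ) • Units.map (e : AlgebraicClosure Kcm →* AlgebraicClosure ℚ) w :
        (AlgebraicClosure ℚ)ˣ) : AlgebraicClosure ℚ) := by
    rw [Units.coe_prod, map_prod, Units.coe_prod]
    refine Finset.prod_congr rfl fun x _ ↦ ?_
    rw [Units.coe_smul, hc, Units.coe_smul, Units.coe_map, MonoidHom.coe_coe]
  rw [step, prod_smul_eq_prod_smul_of_bijective r ⟨hrinj, hrsurj⟩ (t := Quotient.out) (fun q ↦ QuotientGroup.out_eq' q) hwfix,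
    Units.coe_prod]
  simp_rw [Units.coe_smul, Units.coe_map, MonoidHom.coe_coe]
  exact @RowTwo.prod_smul_eq_normOver ℚ _ (F.layer m) (F.layer m') hle instFD instG instFT Quotient.out
    (fun q ↦ QuotientGroup.out_eq' q) ⟨_, hez⟩

/-! ## §2 The coset norms `bₘ = N_{Hₘ/Vₘ}(z_m)` and the twisted norms `Cₘ = ∏_δ (t m δ · bₘ)^{k_δ}` are norm-coherent -/

section Tower

variable {V : ℕ → Subgroup (absoluteGaloisGroup Kcm)} {z : ℕ → (AlgebraicClosure Kcm)ˣ}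
  [hF : ∀ m, Fintype (layerFixing F e m ⧸ (V m).subgroupOf (layerFixing F e m))]

omit [NumberField Kcm] in
/-- `bₘ = ∏_{x ∈ Hₘ/Vₘ} (out x)·z_m` is fixed by `Hₘ`. [cite: Serre1979, X §3 b)] -/
theorem forall_smul_cosetNorm_eq (hz : ∀ m (σ : V m), (σ : absoluteGaloisGroup Kcm) • z m = z m) (m : ℕ) (σ : layerFixing F e m) :
    (σ : absoluteGaloisGroup Kcm) • (∏ x : layerFixing F e m ⧸ (V m).subgroupOf (layerFixing F e m),
        ((Quotient.out x : layerFixing F e m) : absoluteGaloisGroup Kcm) • z m) =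
      ∏ x : layerFixing F e m ⧸ (V m).subgroupOf (layerFixing F e m),
        ((Quotient.out x : layerFixing F e m) : absoluteGaloisGroup Kcm) • z m :=
  forall_smul_prod_smul_eq (fun x ↦ QuotientGroup.out_eq' x) (hz m) σ

omit [NumberField Kcm] in
/-- **`N_{Hₘ/Hₘ₊₁}(bₘ₊₁) = bₘ`**: `N_{Hₘ/Hₘ₊₁} N_{Hₘ₊₁/Vₘ₊₁} = N_{Hₘ/Vₘ₊₁} = N_{Hₘ/Vₘ} N_{Vₘ/Vₘ₊₁}` (transitivity twice) and the norm
relation of the unit tower. [cite: Kato2004Asterisque, §15.5 (p. 253)] [cite: Serre1979, X §3 b)] -/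
theorem cosetNorm_succ_eq (hVo : ∀ m, IsOpen (V m : Set (absoluteGaloisGroup Kcm))) (hVsucc : ∀ m, V (m + 1) ≤ V m)
    (hVH : ∀ m, V m ≤ layerFixing F e m) (hz : ∀ m (σ : V m), (σ : absoluteGaloisGroup Kcm) • z m = z m)
    (hnorm : ∀ (m : ℕ) [Fintype (V m ⧸ (V (m + 1)).subgroupOf (V m))] (τ : V m ⧸ (V (m + 1)).subgroupOf (V m) → V m),
      (∀ x, (τ x : V m ⧸ (V (m + 1)).subgroupOf (V m)) = x) → ∏ x, ((τ x : V m) : absoluteGaloisGroup Kcm) • z (m + 1) = z m)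
    (m : ℕ) [Fintype (layerFixing F e m ⧸ (layerFixing F e (m + 1)).subgroupOf (layerFixing F e m))]
    {τ : layerFixing F e m ⧸ (layerFixing F e (m + 1)).subgroupOf (layerFixing F e m) → layerFixing F e m}
    (hτ : ∀ y, (τ y : layerFixing F e m ⧸ (layerFixing F e (m + 1)).subgroupOf (layerFixing F e m)) = y) :
    ∏ y, ((τ y : layerFixing F e m) : absoluteGaloisGroup Kcm) •
        ∏ x : layerFixing F e (m + 1) ⧸ (V (m + 1)).subgroupOf (layerFixing F e (m + 1)),
        ((Quotient.out x : layerFixing F e (m + 1)) : absoluteGaloisGroup Kcm) • z (m + 1) =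
      ∏ x : layerFixing F e m ⧸ (V m).subgroupOf (layerFixing F e m),
        ((Quotient.out x : layerFixing F e m) : absoluteGaloisGroup Kcm) • z m := by
  classical
  haveI : CompactSpace (absoluteGaloisGroup Kcm) := absoluteGaloisGroup_compactSpace Kcm
  haveI : (V (m + 1)).FiniteIndex := finiteIndex_of_isOpen_of_compactSpace _ (hVo (m + 1))
  letI : Fintype (layerFixing F e m ⧸ (V (m + 1)).subgroupOf (layerFixing F e m)) := Fintype.ofFinite _
  letI : Fintype (V m ⧸ (V (m + 1)).subgroupOf (V m)) := Fintype.ofFinite _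
  have hVH' : V (m + 1) ≤ layerFixing F e (m + 1) := hVH (m + 1)
  have hHH : layerFixing F e (m + 1) ≤ layerFixing F e m := F.layerFixing_antitone e (Nat.le_succ m)
  rw [prod_smul_prod_smul_eq hVH' hHH hτ (fun x ↦ QuotientGroup.out_eq' x) (t₃ := Quotient.out) (fun x ↦ QuotientGroup.out_eq' x)
      (hz (m + 1)),
    ← prod_smul_prod_smul_eq (hVsucc m) (hVH m) (t₁ := Quotient.out) (fun x ↦ QuotientGroup.out_eq' x) (t₂ := Quotient.out)
      (fun x ↦ QuotientGroup.out_eq' x) (t₃ := Quotient.out) (fun x ↦ QuotientGroup.out_eq' x) (hz (m + 1)),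
    hnorm m Quotient.out (fun x ↦ QuotientGroup.out_eq' x)]

variable {ι : Type} [Fintype ι] (k : ι → ℕ) (t : ℕ → ι → absoluteGaloisGroup Kcm)

omit [NumberField Kcm] in
/-- The twisted norm `Cₘ = ∏ᵢ (t m i · bₘ)^{kᵢ}` is fixed by `Hₘ` (`Hₘ ⊴ Γ_K`). [cite: Kato2004Asterisque, 15.14 (p. 264)] [cite: Serre1979, VII §5] -/
theorem forall_smul_twistedNorm_eq [NumberField Kcm] (hz : ∀ m (σ : V m), (σ : absoluteGaloisGroup Kcm) • z m = z m) (m : ℕ)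
    (σ : layerFixing F e m) :
    (σ : absoluteGaloisGroup Kcm) • ∏ i, (t m i • ∏ x : layerFixing F e m ⧸ (V m).subgroupOf (layerFixing F e m),
        ((Quotient.out x : layerFixing F e m) : absoluteGaloisGroup Kcm) • z m) ^ k i =
      ∏ i, (t m i • ∏ x : layerFixing F e m ⧸ (V m).subgroupOf (layerFixing F e m),
        ((Quotient.out x : layerFixing F e m) : absoluteGaloisGroup Kcm) • z m) ^ k i := by
  haveI := F.layerFixing_normal e m
  rw [Finset.smul_prod']
  refine Finset.prod_congr rfl fun i _ ↦ ?_
  rw [smul_pow', forall_smul_smul_eq (t m i) (F.forall_smul_cosetNorm_eq e hz m) σ]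

/-- **`N_{Hₘ/Hₘ₊₁}(Cₘ₊₁) = Cₘ`**: `N(t·bₘ₊₁) = t·N(bₘ₊₁) = t·bₘ` for `t = t (m+1) i` (equivariance, `Hₘ, Hₘ₊₁ ⊴ Γ_K`), and
`t (m+1) i · bₘ = t m i · bₘ` (`(t m i)⁻¹ t (m+1) i ∈ Hₘ`). [cite: Kato2004Asterisque, §15.5 (p. 253) and 15.14 (p. 264)] [cite: Serre1979, X §3 b)] -/
theorem twistedNorm_succ_eq (hVo : ∀ m, IsOpen (V m : Set (absoluteGaloisGroup Kcm))) (hVsucc : ∀ m, V (m + 1) ≤ V m)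
    (hVH : ∀ m, V m ≤ layerFixing F e m) (hz : ∀ m (σ : V m), (σ : absoluteGaloisGroup Kcm) • z m = z m)
    (hnorm : ∀ (m : ℕ) [Fintype (V m ⧸ (V (m + 1)).subgroupOf (V m))] (τ : V m ⧸ (V (m + 1)).subgroupOf (V m) → V m),
      (∀ x, (τ x : V m ⧸ (V (m + 1)).subgroupOf (V m)) = x) → ∏ x, ((τ x : V m) : absoluteGaloisGroup Kcm) • z (m + 1) = z m)
    (htsucc : ∀ m i, (t m i)⁻¹ * t (m + 1) i ∈ layerFixing F e m)
    (m : ℕ) [Fintype (layerFixing F e m ⧸ (layerFixing F e (m + 1)).subgroupOf (layerFixing F e m))]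
    {τ : layerFixing F e m ⧸ (layerFixing F e (m + 1)).subgroupOf (layerFixing F e m) → layerFixing F e m}
    (hτ : ∀ y, (τ y : layerFixing F e m ⧸ (layerFixing F e (m + 1)).subgroupOf (layerFixing F e m)) = y) :
    ∏ y, ((τ y : layerFixing F e m) : absoluteGaloisGroup Kcm) •
        ∏ i, (t (m + 1) i • ∏ x : layerFixing F e (m + 1) ⧸ (V (m + 1)).subgroupOf (layerFixing F e (m + 1)),
        ((Quotient.out x : layerFixing F e (m + 1)) : absoluteGaloisGroup Kcm) • z (m + 1)) ^ k i =
      ∏ i, (t m i • ∏ x : layerFixing F e m ⧸ (V m).subgroupOf (layerFixing F e m),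
        ((Quotient.out x : layerFixing F e m) : absoluteGaloisGroup Kcm) • z m) ^ k i := by
  haveI := F.layerFixing_normal e m
  haveI := F.layerFixing_normal e (m + 1)
  -- push the coset norm inside the product and the powers
  have h1 : ∀ w : (AlgebraicClosure Kcm)ˣ, ∏ y, ((τ y : layerFixing F e m) : absoluteGaloisGroup Kcm) • ∏ i, (t (m + 1) i • w) ^ k i =
      ∏ i, (∏ y, ((τ y : layerFixing F e m) : absoluteGaloisGroup Kcm) • (t (m + 1) i • w)) ^ k i := fun w ↦ by
    simp_rw [Finset.smul_prod', smul_pow']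
    rw [Finset.prod_comm]
    exact Finset.prod_congr rfl fun i _ ↦ Finset.prod_pow _ _ _
  rw [h1]
  refine Finset.prod_congr rfl fun i _ ↦ ?_
  -- equivariance, the norm relation of `b`, and `t (m+1) i · bₘ = t m i · bₘ`
  rw [← smul_prod_smul_eq (t (m + 1) i) hτ (F.forall_smul_cosetNorm_eq e hz (m + 1)),
    F.cosetNorm_succ_eq e hVo hVsucc hVH hz hnorm m hτ]
  congr 1
  have h2 := F.forall_smul_cosetNorm_eq e hz m ⟨_, htsucc m i⟩
  rw [Subgroup.coe_mk, mul_smul, inv_smul_eq_iff] at h2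
  exact h2

/-! ## §3 ★★ Norm-coherent 7th roots of the twisted norms (Kőnig) -/

/-- ★★ **NORM-COHERENT 7th ROOTS OF THE TWISTED NORMS.**  If for every `m ≥ 1` the twisted norm `Cₘ` has an `Hₘ`-fixed 7th root in `K̄`
(the coboundary test L4b at level `m`), then there is a family `a j ∈ (K̄ˣ)^{H_{j+1}}` with `a j ^ 7 = C_{j+1}` whose field norms are
coherent: `N_{F′_{j+2}/F′_{j+1}}(e a_{j+1}) = e a_j` (Kőnig's lemma on the finite non-empty sets of fixed roots, Literature
`exists_normCoherent_roots`, then §1). [cite: Rubin1999, §7 and Lemma 9.3] [cite: Kato2004Asterisque, §15.5 (p. 253) and 15.14 (p. 264)] -/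
theorem exists_normCoherent_seventh_roots
    (hc : ∀ (σ : absoluteGaloisGroup Kcm) (z : AlgebraicClosure Kcm), e (σ • z) = c σ • e z)
    (hbij : Function.Bijective e) (h2 : Module.finrank ℚ Kcm = 2) {s : Kcm} (hs : s ^ 2 = -7)
    (hrange : ∀ g : absoluteGaloisGroup ℚ, g ∈ c.range ↔
      ∀ x : Kcm, g • e (algebraMap Kcm (AlgebraicClosure Kcm) x) = e (algebraMap Kcm (AlgebraicClosure Kcm) x))
    (hVo : ∀ m, IsOpen (V m : Set (absoluteGaloisGroup Kcm))) (hVsucc : ∀ m, V (m + 1) ≤ V m)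
    (hVH : ∀ m, V m ≤ layerFixing F e m) (hz : ∀ m (σ : V m), (σ : absoluteGaloisGroup Kcm) • z m = z m)
    (hnorm : ∀ (m : ℕ) [Fintype (V m ⧸ (V (m + 1)).subgroupOf (V m))] (τ : V m ⧸ (V (m + 1)).subgroupOf (V m) → V m),
      (∀ x, (τ x : V m ⧸ (V (m + 1)).subgroupOf (V m)) = x) → ∏ x, ((τ x : V m) : absoluteGaloisGroup Kcm) • z (m + 1) = z m)
    (htsucc : ∀ m i, (t m i)⁻¹ * t (m + 1) i ∈ layerFixing F e m)
    (hroot : ∀ m, 1 ≤ m → ∃ a : (AlgebraicClosure Kcm)ˣ, (∀ σ : layerFixing F e m, (σ : absoluteGaloisGroup Kcm) • a = a) ∧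
      a ^ 7 = ∏ i, (t m i • ∏ x : layerFixing F e m ⧸ (V m).subgroupOf (layerFixing F e m),
        ((Quotient.out x : layerFixing F e m) : absoluteGaloisGroup Kcm) • z m) ^ k i) :
    ∃ a : ℕ → (AlgebraicClosure Kcm)ˣ,
      (∀ j (σ : layerFixing F e (j + 1)), (σ : absoluteGaloisGroup Kcm) • a j = a j) ∧
      (∀ j, a j ^ 7 = ∏ i, (t (j + 1) i • ∏ x : layerFixing F e (j + 1) ⧸ (V (j + 1)).subgroupOf (layerFixing F e (j + 1)),
        ((Quotient.out x : layerFixing F e (j + 1)) : absoluteGaloisGroup Kcm) • z (j + 1)) ^ k i) ∧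
      (∀ j, e ((a j : (AlgebraicClosure Kcm)ˣ) : AlgebraicClosure Kcm) ∈ F.layer (j + 1)) ∧
      ∀ j (hmem : e ((a (j + 1) : (AlgebraicClosure Kcm)ˣ) : AlgebraicClosure Kcm) ∈ F.layer (j + 2)),
        ((normOver (F.layer (j + 2)) (F.layer (j + 1)) ⟨e ((a (j + 1) : (AlgebraicClosure Kcm)ˣ) : AlgebraicClosure Kcm), hmem⟩ :
          F.layer (j + 2)) : AlgebraicClosure ℚ) = e ((a j : (AlgebraicClosure Kcm)ˣ) : AlgebraicClosure Kcm) := by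
  classical
  haveI : NeZero (7 : ℕ) := ⟨by norm_num⟩
  haveI : CompactSpace (absoluteGaloisGroup Kcm) := absoluteGaloisGroup_compactSpace Kcm
  haveI : ∀ m, (layerFixing F e m).FiniteIndex := fun m ↦ F.finiteIndex_layerFixing_of_le e m (hVo m) (hVH m)
  letI : ∀ j, Fintype (layerFixing F e (j + 1) ⧸ (layerFixing F e (j + 1 + 1)).subgroupOf (layerFixing F e (j + 1))) :=
    fun j ↦ Fintype.ofFinite _
  -- Kőnig along the tower `H_{j+1}`, `j ≥ 0`
  obtain ⟨a, hafix, hapow, hanorm⟩ := exists_normCoherent_roots 7 (fun j ↦ layerFixing F e (j + 1)) (fun j ↦ Quotient.out)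
    (fun j x ↦ QuotientGroup.out_eq' x)
    (fun j ↦ ∏ i, (t (j + 1) i • ∏ x : layerFixing F e (j + 1) ⧸ (V (j + 1)).subgroupOf (layerFixing F e (j + 1)),
        ((Quotient.out x : layerFixing F e (j + 1)) : absoluteGaloisGroup Kcm) • z (j + 1)) ^ k i)
    (fun j ↦ F.twistedNorm_succ_eq e k t hVo hVsucc hVH hz hnorm htsucc (j + 1) fun x ↦ QuotientGroup.out_eq' x)
    (fun j ↦ hroot (j + 1) (Nat.succ_pos j))
  have hmem : ∀ j, e ((a j : (AlgebraicClosure Kcm)ˣ) : AlgebraicClosure Kcm) ∈ F.layer (j + 1) := fun j ↦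
    F.apply_coe_mem_layer e hc hbij h2 hs hrange (j + 1) (hafix j)
  refine ⟨a, hafix, hapow, hmem, fun j hm ↦ ?_⟩
  rw [← F.coe_apply_prod_smul_eq_normOver e hc hbij h2 hs hrange (Nat.le_succ (j + 1)) (fun x ↦ QuotientGroup.out_eq' x) hm,
    hanorm j]

end Tower

end GenusFrame

end Summit.BirchSwinnertonDyer.Rank1Residual.Additive.GenusSeven

end
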